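import Literature.Topology.FourManifolds.KhAntiBigonRotate
import Literature.Topology.FourManifolds.LeeRasmussenInvarianceProofs
import Literature.Topology.FourManifolds.GaussDiagramParityRMoves
import HarnessLib

/-!
# Invariance of Rasmussen's `s` under the anti-parallel second Reidemeister move (`Ω2c/Ω2d`)

Sibling file of `LeeRasmussenInvarianceProofs.lean`. That file proves that Rasmussen's `s` of an
all-even Gauss diagram is invariant under Polyak's moves `GaussDiagram.PolyakMove` (all first
moves, the co-oriented second moves `Ω2a/b`, the braid-like third move) and hence under
`GaussDiagram.Equiv` between realisable diagrams (`rasmussenInvariant_eq_of_equiv_holds`). As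
recorded in `GaussDiagramsRMoves.lean`, that move set does not contain — and by Polyak (2010),
Thm. 1.2 does not generate — the **anti-parallel** second moves `Ω2c, Ω2d`, which every generating
set of oriented Reidemeister moves with the braid-like third move must contain; the enlarged move
set is `GaussDiagram.RMove` (constructor `omega2c`) with its equivalence `GaussDiagram.REquiv`.
This file supplies the missing move for Rasmussen's invariant, with the same three ingredients:
the anti-parallel bigon on Lee's complex (`KhAntiBigonHomotopy`, over the universal Frobenius
system at `(ℚ, 0, 1)`), its reduction to normal position by rotations (`KhAntiBigonRotate`), and
the check that the homotopy equivalence is filtered of degree `0` (Rasmussen (2010), §6):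

* `isFilt_antiBigonMHtpy`, `rasmussenInvariant_antiBigon` — `s` does not change under the
  anti-parallel bigon in normal position (all cube edges merges or splits);
* `rasmussenInvariant_omega2c` — **`s` is invariant under `RMove.omega2c`** at general positions;
* `rasmussenInvariant_eq_of_rMove_of_allEven` — `s` is invariant under every move of `RMove`
  between all-even diagrams, and `rasmussenInvariant_eq_of_eqvGen_rMove_allEven` — under every
  chain of such moves through all-even diagrams (the relation is written out with
  `Relation.EqvGen`, no new definition);
* `rasmussenInvariant_eq_of_rEquiv` — **two realisable Gauss diagrams related by
  `GaussDiagram.REquiv` (all oriented Reidemeister moves, possibly through non-realisable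
  diagrams) have the same `s`**: realisable diagrams are all-even (Gauss), `REquiv`-equivalent
  all-even diagrams are related through all-even diagrams (Manturov's projection for `RMove`,
  `eqvGen_rMove_allEven_of_rEquiv` of `GaussDiagramParityRMoves`), and the previous item. This is
  the analogue for the corrected move set of the discharge `rasmussenInvariant_eq_of_equiv_holds`
  and is what the corrected well-definedness statement `Knot.reidemeisterR` of
  `GaussDiagramsRMoves.lean` consumes.

Everything is proved; no definition and no named fact is introduced.

## References

* J. Rasmussen, *Khovanov homology and the slice genus*, Invent. Math. 182 (2010) 419–447,
  Thm. 1 and §6. [cite: Rasmussen2010, §6]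
* M. Khovanov, *A categorification of the Jones polynomial*, Duke Math. J. 101 (2000), §5.3.
  [cite: Khovanov2000, §5.3]
* M. Polyak, *Minimal generating sets of Reidemeister moves*, Quantum Topol. 1 (2010) 399–411,
  Thm. 1.2, Fig. 2. [cite: Polyak2010, Thm 1.2]
-/

open CategoryTheory Function Finset

noncomputable section

namespace Literature.Topology.FourManifolds

namespace GaussDiagram

open KhElim

/-! ## The anti-parallel bigon in normal position -/

section R2c

variable (G : GaussDiagram) (m : Fin (2 * G.n + 1)) (ε : ℤˣ)
  (hms : ∀ (τ : (G.antiBigon m ε).State) (k : Fin (G.antiBigon m ε).n), τ k = false →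
    (G.antiBigon m ε).IsMergeAt τ k ∨ (G.antiBigon m ε).IsSplitAt τ k)

/-- **The homotopy data of the anti-parallel bigon are filtered in Lee's theory**: relabelling
and rescaling keep the quantum degree, Lee's differential does not decrease it
(`qDegree_le_of_leeIncidence_ne_zero`), and the two cancelled identity blocks `A → P`, `Q → U`
join states of equal quantum degree (they are nonzero entries of Khovanov's graded differential).
Rasmussen (2010), §6 (second move). [cite: Rasmussen2010, §6] -/
theorem isFilt_antiBigonMHtpy :
    (G.antiBigonMHtpy m ε (0 : ℚ) 1 hms).IsFilt (fun s ↦ qDegree s) (fun s ↦ qDegree (antiD m ε s)) := by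
  unfold antiBigonMHtpy
  refine MHtpy.IsFilt.trans (MHtpy.IsFilt.ofEquiv _ _ _ _ (dT := fun a ↦ qDegree (G.embSum' m ε a))
    (fun _ ↦ rfl)) ?_
  refine MHtpy.IsFilt.trans (MHtpy.IsFilt.rescale _ _ _ _) ?_
  have hI : ∀ a b, G.antiBigonJ' m ε (0 : ℚ) 1 a b ≠ 0 →
      qDegree (G.embSum' m ε a) ≤ qDegree (G.embSum' m ε b) := by
    intro a b hab
    apply qDegree_le_of_leeIncidence_ne_zero (G := G.antiBigon m ε)
    intro h0
    apply hab
    unfold antiBigonJ' antiBigonJ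
    rw [h0, mul_zero, zero_mul]
  refine MHtpy.IsFilt.trans (MHtpy.IsFilt.congrRight _ (MHtpy.IsFilt.elim _ _ hI ?_)) ?_
  · intro x
    simp only [embSum_inr_inl', embSum_inl']
    exact qDegree_eq_of_incidence_ne_zero_holds (incidence_embA_embP_self_ne_zero' x)
  · refine MHtpy.IsFilt.congrRight _ (MHtpy.IsFilt.elim _ _ (fun a b hab ↦ hI _ _ hab) ?_)
    intro x
    simp only [embSum_inr_inr_inl', embSum_inr_inr_inr_inl']
    exact qDegree_eq_of_incidence_ne_zero_holds (incidence_embQ_embU_self_ne_zero' x)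

include hms in
/-- **Rasmussen's `s` is invariant under the anti-parallel second Reidemeister move (bigon in
normal position)**, for a bigon all of whose cube edges are merges or splits.
Rasmussen (2010), Thm. 1, §6. [cite: Rasmussen2010, §6] -/
theorem rasmussenInvariant_antiBigon : (G.antiBigon m ε).rasmussenInvariant = G.rasmussenInvariant := by
  have hg := G.isGraded_antiBigonMHtpy m ε hms (G.admissibleDeg_homDegree' m ε (0 : ℚ) 1)
  have hf := G.isFilt_antiBigonMHtpy m ε hms
  symm
  refine (G.antiBigonHtpyData m ε (0 : ℚ) 1 hms).toHtpyEquiv'.rasmussenInvariant_eq_of_qFiltered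
    ?_ ?_ (fun _ _ _ _ _ ↦ rfl) ?_ ?_ ?_
  · intro k w hw s hs
    refine hg.F.apply_eq_zero_fst (i := k) (fun t ht ↦ hw t ?_) ?_
    · simpa [homDegree_antiD] using ht
    · simpa using hs
  · intro k v hv s hs
    refine hg.B.apply_eq_zero_fst (i := k) (fun t ht ↦ hv t (by simpa using ht)) ?_
    simpa [homDegree_antiD] using hs
  · intro k v hv s hs
    refine hg.H.apply_eq_zero_fst (i := k) (fun t ht ↦ hv t (by simpa using ht)) ?_
    simp only [ne_eq]
    intro h
    exact hs (by omega)
  · intro t s hne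
    have := hf.F t s hne
    rwa [qDegree_antiD] at this
  · intro s t hne
    have := hf.B s t hne
    rwa [qDegree_antiD] at this

end R2c

/-- **Rasmussen's `s` is invariant under `Ω2c/Ω2d`** (`RMove.omega2c`), for every instance all of
whose cube edges (of the target) are merges or splits: an anti-parallel bigon in normal position
conjugated by rotations (`insertChord_insertChord_eq_rotate_antiBigon`). Rasmussen (2010), Thm. 1,
§6; Polyak (2010), Fig. 2. [cite: Rasmussen2010, §6] -/
theorem rasmussenInvariant_omega2c (G : GaussDiagram) (o : Fin (2 * G.n + 2)) (u : Fin (2 * G.n + 1))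
    (o' : Fin (2 * (G.n + 1) + 2)) (u' : Fin (2 * (G.n + 1) + 1)) (ε : ℤˣ)
    (hover : (((G.insertChord o u ε).insertChord o' u' (-ε)).overPos (Fin.last (G.n + 1)) : ℕ) =
      ((G.insertChord o u ε).insertChord o' u' (-ε)).overPos (Fin.last G.n).castSucc + 1)
    (hunder : (((G.insertChord o u ε).insertChord o' u' (-ε)).underPos (Fin.last G.n).castSucc : ℕ) =
      ((G.insertChord o u ε).insertChord o' u' (-ε)).underPos (Fin.last (G.n + 1)) + 1)
    (hms : ∀ (τ : ((G.insertChord o u ε).insertChord o' u' (-ε)).State)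
      (k : Fin ((G.insertChord o u ε).insertChord o' u' (-ε)).n), τ k = false →
      ((G.insertChord o u ε).insertChord o' u' (-ε)).IsMergeAt τ k ∨
        ((G.insertChord o u ε).insertChord o' u' (-ε)).IsSplitAt τ k) :
    ((G.insertChord o u ε).insertChord o' u' (-ε)).rasmussenInvariant = G.rasmussenInvariant := by
  rw [G.insertChord_insertChord_eq_rotate_antiBigon o u o' u' ε hover hunder] at hms ⊢
  rw [rasmussenInvariant_rotate, rasmussenInvariant_antiBigon _ _ _ (dichotomy_of_rotate _ _ hms),
    rasmussenInvariant_rotate]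

/-! ## All moves of `RMove` between all-even diagrams -/

/-- **Rasmussen's `s` is invariant under every move of `RMove` between all-even Gauss diagrams**:
the Polyak moves by `rasmussenInvariant_eq_of_polyakMove_of_allEven`, the anti-parallel second
move by `rasmussenInvariant_omega2c` under the merge-or-split dichotomy of the all-even target.
Rasmussen (2010), Thm. 1, §6. [cite: Rasmussen2010, §6] -/
theorem rasmussenInvariant_eq_of_rMove_of_allEven {G H : GaussDiagram} (hm : RMove G H)
    (hG : G.AllEven) (hH : H.AllEven) : H.rasmussenInvariant = G.rasmussenInvariant := by
  cases hm with
  | polyak h => exact rasmussenInvariant_eq_of_polyakMove_of_allEven h hG hH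
  | omega2c o u o' u' ε hover hunder =>
    exact G.rasmussenInvariant_omega2c o u o' u' ε hover hunder (dichotomy_of_allEven hH)

/-- **Rasmussen's `s` is invariant along every chain of moves of `RMove` through all-even Gauss
diagrams** (the equivalence relation generated by "`RMove G H` with `G`, `H` all-even", written
out with `Relation.EqvGen`). With Manturov's parity projection for `RMove` this gives invariance
under `GaussDiagram.REquiv` between realisable diagrams; for the move set `PolyakMove` compare
`rasmussenInvariant_eq_of_evenEquiv`. Rasmussen (2010), Thm. 1, §6. [cite: Rasmussen2010, §6] -/
theorem rasmussenInvariant_eq_of_eqvGen_rMove_allEven {G G' : GaussDiagram}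
    (h : Relation.EqvGen (fun A B ↦ RMove A B ∧ A.AllEven ∧ B.AllEven) G G') :
    G.rasmussenInvariant = G'.rasmussenInvariant := by
  induction h with
  | rel _ _ h => exact (rasmussenInvariant_eq_of_rMove_of_allEven h.1 h.2.1 h.2.2).symm
  | refl _ => rfl
  | symm _ _ _ ih => exact ih.symm
  | trans _ _ _ _ _ ih₁ ih₂ => exact ih₁.trans ih₂

/-- **Invariance of Rasmussen's `s` under all oriented Reidemeister moves**: two *realisable* Gauss
diagrams related by `GaussDiagram.REquiv` (the equivalence generated by `RMove` — Polyak's moves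
together with the anti-parallel second moves `Ω2c/Ω2d` — possibly through non-realisable
diagrams) have the same `s`. Proof: realisable diagrams are all-even (Gauss,
`allEven_of_hasGaussDiagram`); `REquiv`-equivalent all-even diagrams are related by moves of
`RMove` through all-even diagrams (Manturov's projection theorem, `eqvGen_rMove_allEven_of_rEquiv`);
and `s` is invariant along such chains (the homotopy equivalences of the moves on Lee's complex are
filtered of degree `0`, Rasmussen (2010), §6). Rasmussen (2010), Thm. 1; Polyak (2010), Thm. 1.2
(`{Ω1a, Ω1b, Ω2c, Ω2d, Ω3b}` generates all oriented Reidemeister moves); Goussarov–Polyak–Viro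
(2000), Thm. 1.B (the statement's context). [cite: Rasmussen2010, Thm. 1] -/
theorem rasmussenInvariant_eq_of_rEquiv {G G' : GaussDiagram} (hG : ∃ K : Knot, K.HasGaussDiagram G)
    (hG' : ∃ K : Knot, K.HasGaussDiagram G') (e : G.REquiv G') :
    G.rasmussenInvariant = G'.rasmussenInvariant := by
  obtain ⟨K, hK⟩ := hG
  obtain ⟨K', hK'⟩ := hG'
  exact rasmussenInvariant_eq_of_eqvGen_rMove_allEven
    (eqvGen_rMove_allEven_of_rEquiv (allEven_of_hasGaussDiagram hK) (allEven_of_hasGaussDiagram hK') e)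

/-- The same for two regular projections of knots (the form consumed through
`Knot.RegularProjection.diagram`). [cite: Rasmussen2010, Thm. 1] -/
theorem rasmussenInvariant_eq_of_rEquiv_diagram {K K' : Knot} (P : K.RegularProjection)
    (P' : K'.RegularProjection) (e : P.diagram.REquiv P'.diagram) :
    P.diagram.rasmussenInvariant = P'.diagram.rasmussenInvariant :=
  rasmussenInvariant_eq_of_rEquiv ⟨K, P, rfl⟩ ⟨K', P', rfl⟩ e

end GaussDiagram

end Literature.Topology.FourManifolds
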